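import Literature.NumberTheory.EllipticCurves.FineSelmerRankEqualityNonsplitCartanFive
import Literature.NumberTheory.EllipticCurves.DivisionFieldInertiaDeterminant
import HarnessLib

/-!
# The rank-equality road at `(E, 5)` for a `C_ns⁺(5)` image: the inertia hypothesis `σ̄_x¹² ∈ I(𝔮|5)` is AUTOMATIC

Topic `NumberTheory/EllipticCurves` (grouping sub-namespace `CoatesSujatha2005.RankEqualityRoad`, as its parent file).  THEOREM-ONLY
(no definition, no named fact, no `sorry`); prover seat `bsd-potss-k8t-c4` g26 (cell `bsd-potss`, `--supports stmt-BirchSwinnertonDyer-19982`;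
closes nothing; neither BSD nor Conjecture A is booked for any curve).

The parent file (k8t-c4 g25) proves statement (A) of Coates–Sujatha at `(E, 5)` for `E/ℚ` with mod-`5` image in `C_ns⁺(ε)` from two
displayed inputs: the LAYER-0 rank equality `#Cl(ℚ(P))[5] = #Cl(ℚ(x(P)))[5]` (`hrank`) and the inertia condition
`hcI : σ̄_x¹² ∈ I(𝔮)` for every prime `𝔮 ∋ 5` of `ℚ(E[5])`.  HERE `hcI` IS DISCHARGED IN THE KERNEL:

* (private) `pow_twelve_eq_neg_one_of_det_eq_two` — finite fact: every `M ∈ C_ns⁺(ε) ≤ GL₂(𝔽₅)` (`ε ∈ {2,3}`) with `det M = 2` satisfies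
  `M¹² = −1` (an element whose determinant generates `𝔽₅ˣ` has order `8` or `24`, and the unique involution of `C_ns(5) ≅ 𝔽₂₅ˣ` is `−1`;
  `decide`);
* `pow_twelve_mem_inertia_of_nonsplitCartanNormalizer` — for EVERY maximal `𝔮 ∋ 5` of `𝓞 ℚ(E[5])`: `σ̄_x¹² ∈ I(𝔮)`.  By
  `DivisionFieldInertia.exists_mem_inertia_divisionField_det_rep_eq` (`det ρ̄_{E,5}(I(𝔮|5)) = 𝔽₅ˣ`: Weil pairing + `ℚ(ζ₅)/ℚ` totally
  ramified at `5`) the inertia group contains `g` with `det ρ̄(g) = 2`; `ρ̄(g) ∈ C_ns⁺(ε)`, so `ρ̄(g¹²) = −1 = ρ̄(σ̄_x¹²)`, and `ρ̄` is faithful;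
* `conjA_five_of_nonsplitCartanBasis_of_rankEq'` — the parent file's §2 WITHOUT `hcI`: statement (A) at `(E,5)` from the basis data
  and the single class-group datum `hrank` (the general-`K` layer statement of the parent's §1 takes `hcI` as an input and is fed by
  `pow_twelve_mem_inertia_of_nonsplitCartanNormalizer` at `K = ℚ` inside the parent's §2; no `k = ℚ` restatement of §1 is given, cf.
  the instance remark in `EquivariantIwasawaLemmaTotallyRamified`).

## References

* J.-P. Serre, *Propriétés galoisiennes des points d'ordre fini des courbes elliptiques*, Invent. Math. 15 (1972), §2.2, §5.2 (iii). [Serre1972]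
* J. Coates, R. Sujatha, *Fine Selmer groups of elliptic curves over p-adic Lie extensions*, Math. Ann. 331 (2005), §3 Thm. 3.4. [CoatesSujatha2005]
* K. Iwasawa, *A note on class numbers of algebraic number fields*, Abh. Math. Sem. Hamburg 20 (1956). [Iwasawa1956]
-/

set_option autoImplicit false

noncomputable section

open scoped Classical NumberField Matrix
open WeierstrassCurve Field IntermediateField
  Literature.NumberTheory.GaloisRepresentations Literature.NumberTheory.SerreUniformity
  Literature.NumberTheory.IwasawaTheory
  Literature.NumberTheory.NumberFields Literature.NumberTheory.EllipticCurves.DivisionFieldInertia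

namespace Literature.NumberTheory.EllipticCurves.CoatesSujatha2005

namespace RankEqualityRoad

/-! ### §0 Finite facts and helpers -/

/-- In `C_ns(2) ≤ GL₂(𝔽₅)`: `det M = 2 ⇒ M¹² = −1`. [folklore] -/
private theorem c2_det_two : ∀ a b : ZMod 5, (!![a, 2 * b; b, a] : Matrix (Fin 2) (Fin 2) (ZMod 5)).det = 2 →
    ((!![a, 2 * b; b, a] : Matrix (Fin 2) (Fin 2) (ZMod 5)) ^ 4) ^ 3 = -1 := by
  decide

/-- In `C_ns(3) ≤ GL₂(𝔽₅)`: `det M = 2 ⇒ M¹² = −1`. [folklore] -/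
private theorem c3_det_two : ∀ a b : ZMod 5, (!![a, 3 * b; b, a] : Matrix (Fin 2) (Fin 2) (ZMod 5)).det = 2 →
    ((!![a, 3 * b; b, a] : Matrix (Fin 2) (Fin 2) (ZMod 5)) ^ 4) ^ 3 = -1 := by
  decide

/-- In `C_ns⁺(2) ∖ C_ns(2)`: `det M = 2 ⇒ M¹² = −1`. [folklore] -/
private theorem n2_det_two : ∀ a b : ZMod 5, (!![a, -(2 * b); b, -a] : Matrix (Fin 2) (Fin 2) (ZMod 5)).det = 2 →
    ((!![a, -(2 * b); b, -a] : Matrix (Fin 2) (Fin 2) (ZMod 5)) ^ 4) ^ 3 = -1 := by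
  decide

/-- In `C_ns⁺(3) ∖ C_ns(3)`: `det M = 2 ⇒ M¹² = −1`. [folklore] -/
private theorem n3_det_two : ∀ a b : ZMod 5, (!![a, -(3 * b); b, -a] : Matrix (Fin 2) (Fin 2) (ZMod 5)).det = 2 →
    ((!![a, -(3 * b); b, -a] : Matrix (Fin 2) (Fin 2) (ZMod 5)) ^ 4) ^ 3 = -1 := by
  decide

/-- The non-squares of `𝔽₅` are `2` and `3`. [folklore] -/
private theorem eq_two_or_three_of_not_isSquare₃ {ε : ZMod 5} (hε : ¬ IsSquare ε) : ε = 2 ∨ ε = 3 := by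
  have key : ∀ e : ZMod 5, e = 0 ∨ e = 1 ∨ e = 4 ∨ e = 2 ∨ e = 3 := by decide
  rcases key ε with h | h | h | h | h
  · exact absurd ⟨0, by rw [h, mul_zero]⟩ hε
  · exact absurd ⟨1, by rw [h, mul_one]⟩ hε
  · exact absurd ⟨2, by rw [h]; decide⟩ hε
  · exact Or.inl h
  · exact Or.inr h

/-- **Finite fact.** Every element of `C_ns⁺(ε) ≤ GL₂(𝔽₅)` (`ε` a non-square) of determinant `2` has twelfth power `−1`: its
determinant generates `𝔽₅ˣ`, so its order is `8` or `24`, and `−1` is the unique involution of `C_ns(5) ≅ 𝔽₂₅ˣ` and the square of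
every element of order `4` of `C_ns⁺(5)`. [folklore] -/
private theorem pow_twelve_eq_neg_one_of_det_eq_two {ε : ZMod 5} (hε : ¬ IsSquare ε) {M : Matrix (Fin 2) (Fin 2) (ZMod 5)}
    (hM : M ∈ nonsplitCartanNormalizer ε) (hdet : M.det = 2) : M ^ 12 = -1 := by
  have hε' := eq_two_or_three_of_not_isSquare₃ hε
  rw [show (12 : ℕ) = 4 * 3 by norm_num, pow_mul]
  obtain ⟨a, b, -, rfl | rfl⟩ := hM
  · rcases hε' with rfl | rfl
    exacts [c2_det_two a b hdet, c3_det_two a b hdet]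
  · rcases hε' with rfl | rfl
    exacts [n2_det_two a b hdet, n3_det_two a b hdet]

/-- `R_ε¹² = −1` for `R_ε = (1 ε(4−ε); 4−ε 1)`, `ε ∈ {2, 3}`. [folklore] -/
private theorem R_pow_twelve₃ {ε : ZMod 5} (hε : ε = 2 ∨ ε = 3) :
    (!![1, ε * (4 - ε); 4 - ε, 1] : Matrix (Fin 2) (Fin 2) (ZMod 5)) ^ 12 = -1 := by
  rcases hε with rfl | rfl <;> decide

/-- Two matrices acting alike on all `e P` coincide (`e` onto). [folklore] -/
private theorem matrix_eq_of_forall_mulVec₃ {A : Type*} [AddCommGroup A] {n : ℕ} (e : A ≃+ (Fin 2 → ZMod n))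
    {M N : Matrix (Fin 2) (Fin 2) (ZMod n)} (h : ∀ P : A, M *ᵥ e P = N *ᵥ e P) : M = N := by
  have h' : ∀ v, M *ᵥ v = N *ᵥ v := fun v => by simpa using h (e.symm v)
  ext i j
  have := congrFun (h' (Pi.single j 1)) i
  simpa [Matrix.mulVec_single] using this

/-- Restriction `Γ_F → Gal(E/F)` is onto. [folklore] -/
private theorem absRestrictNormalHom_surjective₃ {F : Type} [Field F] (E : IntermediateField F (AlgebraicClosure F))
    [Normal F E] : Function.Surjective (absRestrictNormalHom E) := fun g => by
  obtain ⟨σ, hσ⟩ := AlgEquiv.restrictNormalHom_surjective (AlgebraicClosure F) g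
  exact ⟨(Field.absoluteGaloisGroup.toAlgEquiv F).symm σ, hσ⟩

/-! ### §1 `σ̄_x¹² ∈ I(𝔮)` for every prime `𝔮 ∋ 5` of `ℚ(E[5])` -/

/-- **The inertia hypothesis of the rank-equality road is automatic.**  `E/ℚ` elliptic with `Γ_ℚ` acting on `E[5]` through
`C_ns⁺(ε)` in a basis `e`, `σ_x ↦ R_ε = (1 ε(4−ε); 4−ε 1)` (so `σ̄_x¹² = −1`).  Then for EVERY maximal ideal `𝔮 ∋ 5` of `𝓞 ℚ(E[5])`,
`σ̄_x¹²` lies in the inertia group `I(𝔮) ≤ Gal(ℚ(E[5])/ℚ)`: `I(𝔮)` contains an element `g` with `det ρ̄(g) = 2`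
(`DivisionFieldInertia.exists_mem_inertia_divisionField_det_rep_eq` — Weil pairing + `ℚ(ζ₅)/ℚ` totally ramified at `5`), `ρ̄(g) ∈ C_ns⁺(ε)`
forces `ρ̄(g)¹² = −1 = ρ̄(σ̄_x¹²)` (`pow_twelve_eq_neg_one_of_det_eq_two`), and `ρ̄` is faithful on `Gal(ℚ(E[5])/ℚ)`.
[cite: Serre1972, §5.2 (iii) and §2.2] -/
theorem pow_twelve_mem_inertia_of_nonsplitCartanNormalizer (W : WeierstrassCurve ℚ) [W.IsElliptic]
    (e : W.geomTorsion (5 : ℕ) ≃+ (Fin 2 → ZMod 5)) {ε : ZMod 5} (hε : ¬ IsSquare ε)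
    (he : ∀ σ : absoluteGaloisGroup ℚ, ∃ M ∈ nonsplitCartanNormalizer ε, ∀ P : W.geomTorsion (5 : ℕ), e (σ • P) = M *ᵥ e P)
    (σx : absoluteGaloisGroup ℚ) (hσx : ∀ P : W.geomTorsion (5 : ℕ), e (σx • P) = !![1, ε * (4 - ε); 4 - ε, 1] *ᵥ e P)
    (𝔮 : Ideal (𝓞 ↥(W.divisionField 5))) [𝔮.IsMaximal] (h𝔮 : ((5 : ℕ) : 𝓞 ↥(W.divisionField 5)) ∈ 𝔮) :
    absRestrictNormalHom (W.divisionField 5) σx ^ 12 ∈ 𝔮.inertia (↥(W.divisionField 5) ≃ₐ[ℚ] ↥(W.divisionField 5)) := by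
  haveI : Fact (Nat.Prime 5) := ⟨by norm_num⟩
  have hε' := eq_two_or_three_of_not_isSquare₃ hε
  -- the faithful matrix representation of `Gal(ℚ(E[5])/ℚ)` in the basis `e`
  obtain ⟨ρm, hρm, hρme⟩ := exists_matrixRep_divisionField W 5 e
  have hmat : ∀ (σ : absoluteGaloisGroup ℚ) (M : Matrix (Fin 2) (Fin 2) (ZMod 5)),
      (∀ P, e (σ • P) = M *ᵥ e P) → ρm (absRestrictNormalHom _ σ) = M :=
    fun σ M hM => matrix_eq_of_forall_mulVec₃ e fun P => by rw [← hρme, hM]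
  -- an inertia element of determinant `2`
  obtain ⟨g, hgI, hgdet⟩ := exists_mem_inertia_divisionField_det_rep_eq W 5 e ρm hρme 𝔮 h𝔮
    (ZMod.unitOfCoprime 2 (by norm_num))
  rw [ZMod.coe_unitOfCoprime, Nat.cast_ofNat] at hgdet
  obtain ⟨σ, rfl⟩ := absRestrictNormalHom_surjective₃ (W.divisionField 5) g
  obtain ⟨M, hM, hMe⟩ := he σ
  have hρσ : ρm (absRestrictNormalHom _ σ) = M := hmat σ M hMe
  have hM12 : M ^ 12 = -1 := pow_twelve_eq_neg_one_of_det_eq_two hε hM (by rw [← hρσ]; exact hgdet)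
  have hx12 : ρm (absRestrictNormalHom _ σx ^ 12) = -1 := by
    rw [map_pow, hmat σx _ hσx]; exact R_pow_twelve₃ hε'
  have heq : absRestrictNormalHom (W.divisionField 5) σx ^ 12 = absRestrictNormalHom (W.divisionField 5) σ ^ 12 :=
    hρm (by rw [hx12, map_pow, hρσ, hM12])
  rw [heq]
  exact Subgroup.pow_mem _ hgI 12

/-! ### §2 The rank-equality road over `ℚ` without the inertia hypothesis -/

set_option maxHeartbeats 1600000 in
set_option synthInstance.maxHeartbeats 400000 in
/-- **(A) at `(E, 5)` for a `C_ns⁺(5)`-row FROM THE RANK EQUALITY ALONE — no named fact, no `μ`-hypothesis, no inertia hypothesis.**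
`E/ℚ` elliptic with `Γ_ℚ` acting on `E[5]` through `C_ns⁺(ε)` in the basis `e` (`σ_x ↦ R_ε`, `σ_s ↦ diag(1,4)`); if
`#Cl(ℚ(P))[5] = #Cl(ℚ(x(P)))[5]` (`ℚ(P) = ℚ(E[5])^{⟨σ̄_s⟩}`, `ℚ(x(P)) = ℚ(E[5])^{⟨σ̄_x¹², σ̄_s⟩}`), then the dual fine Selmer group of `E`
over `ℚ_cyc` is finitely generated over `ℤ_5` for every cyclotomic `ℤ_5`-extension: the parent file's
`conjA_five_of_nonsplitCartanBasis_of_rankEq` with `hcI` supplied by `pow_twelve_mem_inertia_of_nonsplitCartanNormalizer`.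
[cite: CoatesSujatha2005, §3 Thm. 3.4 and Lemma 3.8] [cite: Iwasawa1956, §§3–5] [cite: Serre1972, §2.2 and §5.2 (iii)] -/
theorem conjA_five_of_nonsplitCartanBasis_of_rankEq' (W : WeierstrassCurve ℚ) [W.IsElliptic]
    (e : W.geomTorsion (5 : ℕ) ≃+ (Fin 2 → ZMod 5)) {ε : ZMod 5} (hε : ¬ IsSquare ε)
    (he : ∀ σ : absoluteGaloisGroup ℚ, ∃ M ∈ nonsplitCartanNormalizer ε, ∀ P : W.geomTorsion (5 : ℕ), e (σ • P) = M *ᵥ e P)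
    (σx σs : absoluteGaloisGroup ℚ) (hσx : ∀ P : W.geomTorsion (5 : ℕ), e (σx • P) = !![1, ε * (4 - ε); 4 - ε, 1] *ᵥ e P)
    (hσs : ∀ P : W.geomTorsion (5 : ℕ), e (σs • P) = !![1, 0; 0, 4] *ᵥ e P)
    (hrank : Nat.card {d : ClassGroup (𝓞 ↥(fixedField (Subgroup.zpowers (absRestrictNormalHom (W.divisionField 5) σs)))) // d ^ 5 = 1} =
      Nat.card {d : ClassGroup (𝓞 ↥(fixedField (Subgroup.zpowers (absRestrictNormalHom (W.divisionField 5) σx ^ 12) ⊔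
        Subgroup.zpowers (absRestrictNormalHom (W.divisionField 5) σs)))) // d ^ 5 = 1})
    (κ : ZpExtension ℚ 5) (hκ : κ.IsCyclotomic) :
    ∃ (γ : absoluteGaloisGroup ℚ) (D : W.FineSelmerDualData κ γ),
      Module.Finite ℤ_[5] (RestrictScalars ℤ_[5] (IwasawaAlgebra 5) D.X) :=
  haveI : Fact (Nat.Prime 5) := ⟨by norm_num⟩
  conjA_five_of_nonsplitCartanBasis_of_rankEq W e hε he σx σs hσx hσs hrank
    (fun 𝔮 _ h𝔮 => pow_twelve_mem_inertia_of_nonsplitCartanNormalizer W e hε he σx hσx 𝔮 h𝔮) κ hκ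

end RankEqualityRoad

end Literature.NumberTheory.EllipticCurves.CoatesSujatha2005

end
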